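/-
Origin: expansion seat `planner-pub-hodgecm-mc-glue-1-g11-0`, handover #SG18 2026-08-20T16:55:47Z md5 ebbbfa6c48bb (REPLACE; pre md5 1ba69ca7e04f → new md5 ebbbfa6c48bb; 243 l.; (μ4) scope-guard rewrite of the RUN-55 installed file; family glue-1; compiled ok 0 proof-hole) (`HOME/mc/pub-hodgecm-mc-glue-1-g11/stage56/HodgeCM/Model/E2InstanceOGR21AEPISCWRT.lean`, md5 ebbbfa6c48bb, 243 lines);
landed by the second packager p2 gen 10 (p2-g10) in gate run 56 REPLACES the earlier landed copy of `HodgeCM/Model/E2InstanceOGR21AEPISCWRT.lean` (seat copy carried the packager Origin header of an earlier run (stripped)).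
-/
/-
Origin: CONSTRUCTION seat `planner-pub-hodgecm-mc-glue-1-g10-0` (unit pub-hodgecm-mc-glue-1-g10, gen 10 of mc-glue-1, node E ASSEMBLER),
generated from `stage44/HodgeCM/Model/E2InstanceOGR21AEPISCW.lean` ((P4)) and the `CT` binder text of binder-1-g11's staged
`HodgeCM/Model/Binders/Real34PinsROGT.lean` (#42) by `tools/gen_ogiscwrt.py`; KERNEL only: 1 theorem, 0 defs; intended closure
{propext, Classical.choice, Quot.sound}.  The ROW-17 CHILD of the W pin child: `real34` DISCHARGED at binder-1 #42 `Gen12PinsP.real34_ROGET` from E's OWN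
`hR`/`hΘ` modulo ONE residual family `CT` (the SATISFIABLE census-T record, binder-1-g11 FINDING l.12843); record status is the lead's ruling, not this file's claim.
-/
import Summits.HodgeConjecture.HodgeCM.Model.E2InstanceOGR21AEPISCW
import Summits.HodgeConjecture.HodgeCM.Model.Binders.Real34PinsROGT

/-!
# E2InstanceOGR21AEPISCWRT — the row-17 child of `perL_picardCM_r21AEOGISCW` over the census-T record (supersedes the withdrawn `…CWR`)

`perL_picardCM_r21AEOGISCWRT` = `perL_picardCM_r21AEOGISCW` ((P4): #397 with `W := HypCensus.Wcm hGR η′ hη′ hηc′` at the S pin's character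
`η′ := EtaChi.η χV (SInstance.χWR hGR hGR₀ hGR₁ μ)`, rows 18/19 at #56, row 16 at binder-1 #37; 24 groups) with row 17 `real34` DISCHARGED by
binder-1-g11's `Gen12PinsP.real34_ROGET hGR χV hGR₀..₃ μ hΔ₁ hΔ₂ hΔ₃ hHD hI h₁ h₃′ hA h31 hLiu CT` (`Binders/Real34PinsROGT`, #42 over
#41 `Real34PinsCensusT`, #40 `Real34WedgeSpan`, #39 `Real34PinsROG`, #38 `Real34PinsTotalPK` and RUN-43 #36/#37; its conclusion IS E's row-17
binder text at these pins, byte-for-byte, `h₃′ := cmAbelianVarietyRealised_of_eigenbasis hHD hI h₃`), the three inputs supplied thus: `h31 :=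
fact_cmInflation_riemann hHD hI h₃′ h₁ hR` (E's own row `hR`, as in `E2InstanceOGR20AE`); `hLiu` (C3 up to CM-inflation at every good sextic
canonical context, all types and ALL levels) := E's OWN derivation of record, re-run at the pins — the guarded `hsmall` from `hΘ` + `hR` by
`span_classes_le_Uiso` (the `E2InstanceOGR21AE` lambda, verbatim) and the passage to all levels by `(thetaModelOf …).isotypic_of_small
(levelTransferFamilyOf … (normOf …) (pushOf_comp_pull_eq_pull_normOf …)) V c i (thetaSatOf …) hsmall Γ` (the `E2InstanceOGR20AE` lambda,
verbatim) — so NO `hLiu`/`hsmall` group enters; `CT` := the ONE new E-level residual family (binder-1's declared row-15 residual in its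
SATISFIABLE census-T form, binder-1-g11 FINDING 2026-08-20 l.12843: the earlier record `Real34CensusSide` with `hwedge` as typed is empty at every
good sextic context, whence the withdrawn `…CWR`; one hypothesis record `Gen12PinsP.Real34CensusSideT @SInstance.GOG @SInstance.hG_GOG @hGR @η′ @hη′
@hηc′ @hGR₀..₃ @(SInstance.AR …) hHD hI h₁ h₃′ (orientBitι L ι₁) hA @μ V c (isAnisotropic_of_goodCtx V hc hK)` per good sextic CANONICAL context =
binder-2's (34) census core at the W pin ⊕ `hwedgeT` «inserted census letters agree with admissible wedge sums UP TO (34)-PERIOD EQUIVALENCE»; text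
verbatim from #42's `real34_ROGET` up to `h₃ ↦ h₃′` and the namespace prefix).
Binder groups: `hA hGR χV hGR₀ hGR₁ hGR₂ hGR₃ μ hΔ₁ hΔ₂ hΔ₃ hR hΘ harch₀ hχ₀ harch₁ hχ₁ CT jD hκ homg homg₃₄ hdense₁₂ hdense₃₄` (24 = 24 − 1 + 1);
every other text is (P4)'s byte-for-byte; the (C-LINE1) LABEL of #397 on `harch₁`/`hχ₁` stands verbatim (displayed AS TYPED, not PROVE residuals);
conclusion `Universe.PerL` unchanged; proof = ONE application.  ADDITIVE LEAF of the closing chain; no new definition, record or cite enters;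
nothing of PerL ∕ QW8 is claimed.
-/

noncomputable section

open scoped TensorProduct InnerProductSpace Matrix

open Literature.NumberTheory.Automorphic Literature.NumberTheory.Weil1964
open Literature.NumberTheory.GelbartRogawski1991.UnitaryDualPair
open HodgeCM.Adelic HodgeCM.PerL34
open scoped Classical
open Literature.Geometry.ComplexHyperbolic.BallModel (U21 x₀ stabilizerEquivK21)
open Literature.NumberTheory.Automorphic.U21 (K21 matA sclD)

namespace HodgeCM

namespace Model

open HodgeCM.Model.ArchSideTerm
open HodgeCM.Universe (AdelicThetaCore AdelicThetaCore₀ SideData ThetaModel ModelAxiomsPerL)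
open Literature.AlgebraicGeometry.HodgeTheory
open Literature.AlgebraicGeometry.ComplexMultiplication (Shimura1998_Thm3_isogenousPower Shimura1998_Thm2_Cor)
open Literature.NumberTheory.Automorphic.PicardCM
open Literature.NumberTheory.Transcendental (Arapura2012_Cor_15_4_6)
open HodgeCM.CMTypeOps (inflate)
open HodgeCM.Model.SupplyResidual (ClassSupplyPackN)
open HodgeCM.Model.ThetaSpace

variable (hHD : exists_isReal_hodgeModel) (hI : hodgePQ_independent_of_hodgeModel)
  (h₁ : BallQuotientUniformised)  (h₃ : CMAbelianVarietyEigenbasisRealised)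

/-- **ROW-17 CHILD of the W pin child, census-T form** (`real34` at binder-1 #42 `real34_ROGET` from E's own `hR`/`hΘ`, modulo the ONE
residual family `CT : … → Gen12PinsP.Real34CensusSideT …`; 24 binder groups; (C-LINE1) label of #397 on `harch₁`/`hχ₁` stands). -/
theorem perL_picardCM_r21AEOGISCWRT (hA : Arapura2012_Cor_15_4_6)
    (hGR : ∀ {L : CMField} {ι₁ : L →+* ℂ} (V : HermSpace3 L ι₁) (c : SeesawCtx L),
      (cmSplittingDatum (L : Type) finProdFinEquiv (frameD V) (frameD_real V) (frameD_ne V) (dW c.D) (dW_real c.D)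
        (dW_ne c.D)).CompatibleSplitting)
    (χV : ∀ {L : CMField} {ι₁ : L →+* ℂ} (_V : HermSpace3 L ι₁) (_c : SeesawCtx L),
      ContinuousMonoidHom (relNormOneIdeles (↥(NumberField.maximalRealSubfield (L : Type))) (L : Type) ⧸
        relNormOneRat (↥(NumberField.maximalRealSubfield (L : Type))) (L : Type)) Circle)
    (hGR₀ : ∀ {L : CMField} {ι₁ : L →+* ℂ} (V : HermSpace3 L ι₁) (c : SeesawCtx L),
      (cmSplittingDatum (L : Type) (e₁) (frameD V) (frameD_real V) (frameD_ne V) (lineVec (L : Type) (dW c.D 0))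
        (fun _ => dW_real c.D 0) (fun _ => dW_ne c.D 0)).CompatibleSplitting)
    (hGR₁ : ∀ {L : CMField} {ι₁ : L →+* ℂ} (V : HermSpace3 L ι₁) (c : SeesawCtx L),
      (cmSplittingDatum (L : Type) (e₁) (frameD V) (frameD_real V) (frameD_ne V) (lineVec (L : Type) (dW c.D 1))
        (fun _ => dW_real c.D 1) (fun _ => dW_ne c.D 1)).CompatibleSplitting)
    (hGR₂ : ∀ {L : CMField} {ι₁ : L →+* ℂ} (V : HermSpace3 L ι₁) (c : SeesawCtx L),
      (cmSplittingDatum (L : Type) (e₁) (frameD V) (frameD_real V) (frameD_ne V) (lineVec (L : Type) (dW' c.D 0))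
        (fun _ => dW'_real c.D 0) (fun _ => dW'_ne c.D 0)).CompatibleSplitting)
    (hGR₃ : ∀ {L : CMField} {ι₁ : L →+* ℂ} (V : HermSpace3 L ι₁) (c : SeesawCtx L),
      (cmSplittingDatum (L : Type) (e₁) (frameD V) (frameD_real V) (frameD_ne V) (lineVec (L : Type) (dW' c.D 1))
        (fun _ => dW'_real c.D 1) (fun _ => dW'_ne c.D 1)).CompatibleSplitting)
    (μ : ∀ {L : CMField}, SeesawCtx L → Fin 4 → NumberField.InfinitePlace L → ℤ)
    (hΔ₁ : ∀ {L : CMField} {ι₁ : L →+* ℂ} (V : HermSpace3 L ι₁) (c : SeesawCtx L), ∀ hc : SInstance.GOG V c,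
      slotTypeVec V c (hGR V c) (hGR₀ V c) (hGR₁ V c) (hGR₂ V c) (hGR₃ V c) (SInstance.hG_GOG V c hc) 1 -
        slotTypeVec V c (hGR V c) (hGR₀ V c) (hGR₁ V c) (hGR₂ V c) (hGR₃ V c) (SInstance.hG_GOG V c hc) 0 = μ c 1 - μ c 0)
    (hΔ₂ : ∀ {L : CMField} {ι₁ : L →+* ℂ} (V : HermSpace3 L ι₁) (c : SeesawCtx L), ∀ hc : SInstance.GOG V c,
      slotTypeVec V c (hGR V c) (hGR₀ V c) (hGR₁ V c) (hGR₂ V c) (hGR₃ V c) (SInstance.hG_GOG V c hc) 2 -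
        slotTypeVec V c (hGR V c) (hGR₀ V c) (hGR₁ V c) (hGR₂ V c) (hGR₃ V c) (SInstance.hG_GOG V c hc) 0 = μ c 2 - μ c 0)
    (hΔ₃ : ∀ {L : CMField} {ι₁ : L →+* ℂ} (V : HermSpace3 L ι₁) (c : SeesawCtx L), ∀ hc : SInstance.GOG V c,
      slotTypeVec V c (hGR V c) (hGR₀ V c) (hGR₁ V c) (hGR₂ V c) (hGR₃ V c) (SInstance.hG_GOG V c hc) 3 -
        slotTypeVec V c (hGR V c) (hGR₀ V c) (hGR₁ V c) (hGR₂ V c) (hGR₃ V c) (SInstance.hG_GOG V c hc) 0 = μ c 3 - μ c 0)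
    (hR : DeligneMilne1982_Thm_6_20_full)
    (hΘ : ∀ {L : CMField} {ι₁ : L →+* ℂ} (V : HermSpace3 L ι₁) (c : SeesawCtx L),
      (thetaModelOf hHD hI h₁ (cmAbelianVarietyRealised_of_eigenbasis hHD hI h₃) (orientBitι L ι₁) (embOf hHD hI h₁ (cmAbelianVarietyRealised_of_eigenbasis hHD hI h₃)) (coverOf hHD hI h₁ (cmAbelianVarietyRealised_of_eigenbasis hHD hI h₃) hA) (wmOfInput (HypCensus.Wcm hGR (@EtaChi.η @χV (@SInstance.χWR @hGR @hGR₀ @hGR₁ @μ)) (@EtaChi.hη @χV (@SInstance.χWR @hGR @hGR₀ @hGR₁ @μ)) (@EtaChi.hηc @χV (@SInstance.χWR @hGR @hGR₀ @hGR₁ @μ)))) (thetaOf _ (thetaClassInputOf _ (fun V c => thetaSpaceInputOf hHD hI h₁ (cmAbelianVarietyRealised_of_eigenbasis hHD hI h₃) (SInstance.SROG @hGR @χV @hGR₀ @hGR₁ @hGR₂ @hGR₃ @μ hΔ₁ hΔ₂ hΔ₃) V c))) (d12Of μ) (d34Of μ)).GoodCtx ι₁ c → Module.finrank ℚ c.K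 = 6 ∧ IsNormalClosure ℚ c.K L ∧ (Module.finrank ℚ L = 24 ∨ Module.finrank ℚ L = 48) →
      (NumberField.InfinitePlace.mk ι₁).embedding = ι₁ →
      ∀ i : Fin 4, ∃ Γ₀ : Level V, ∀ Γ ≤ Γ₀,
        ∃ D : CommonReflexInput c.K (c.Ψ i) c.σ,
          (thetaModelOf hHD hI h₁ (cmAbelianVarietyRealised_of_eigenbasis hHD hI h₃) (orientBitι L ι₁) (embOf hHD hI h₁ (cmAbelianVarietyRealised_of_eigenbasis hHD hI h₃)) (coverOf hHD hI h₁ (cmAbelianVarietyRealised_of_eigenbasis hHD hI h₃) hA) (wmOfInput (HypCensus.Wcm hGR (@EtaChi.η @χV (@SInstance.χWR @hGR @hGR₀ @hGR₁ @μ)) (@EtaChi.hη @χV (@SInstance.χWR @hGR @hGR₀ @hGR₁ @μ)) (@EtaChi.hηc @χV (@SInstance.χWR @hGR @hGR₀ @hGR₁ @μ)))) (thetaOf _ (thetaClassInputOf _ (fun V c => thetaSpaceInputOf hHD hI h₁ (cmAbelianVarietyRealised_of_eigenbasis hHD hI h₃) (SInstance.SROG @hGR @χV @hGR₀ @hGR₁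 @hGR₂ @hGR₃ @μ hΔ₁ hΔ₂ hΔ₃) V c))) (d12Of μ) (d34Of μ)).Theta V c i Γ ⊆
            Submodule.span ℂ (D.surfaceClasses hHD hI h₁ (cmAbelianVarietyRealised_of_eigenbasis hHD hI h₃) V Γ))
    (harch₀ : ∀ {L : CMField} {ι₁ : L →+* ℂ} (V : HermSpace3 L ι₁) (c : SeesawCtx L) (hV : IsAnisotropic L V.Hm) (hG : SInstance.GOG V c) (N : ℕ), ∀ a : UnitaryGroup.arch (↥(NumberField.maximalRealSubfield L)) L (NumberField.IsCMField.complexConj L) 3 V.Hm,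
    UnitaryGroup.archAt (↥(NumberField.maximalRealSubfield L)) L (NumberField.IsCMField.complexConj L) 3 V.Hm (UnitaryGroup.cmPlace (L : Type) ι₁)
        (NumberField.complexConj_smul_infinitePlace (L : Type) _) (NumberField.IsCMField.complexConj_ne_one (L : Type)) a = 1 →
    ∀ ℓ, lineRepD V c.D (hGR V c) (hGR₀ V c) (hGR₁ V c) (hGR₂ V c) (hGR₃ V c) (EtaChi.η @χV (@SInstance.χWR @hGR @hGR₀ @hGR₁ @μ) V c) 0
        (HodgeCM.Adelic.regimeEquiv L V.Hm hV
          (UnitaryGroup.archToAdelic (↥(NumberField.maximalRealSubfield L)) L (NumberField.IsCMField.complexConj L) 3 V.Hm a), 1)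
        (SupplyInstance.testFun (↥(NumberField.maximalRealSubfield L)) (Fin 3)
          (blockFamilyOfAt (L : Type) e₁ (frameD V) (frameD_real V) (frameD_ne V) (lineVec (L : Type) (dW c.D 0))
            (fun _ => dW_real c.D 0) (fun _ => dW_ne c.D 0) ι₁ (blockPosEquiv V) (blockNegEquiv V)
            (posIdxEquivUnit (SInstance.hpos_GOG V c hG).1) (negIdxEquivEmpty (SInstance.hpos_GOG V c hG).1) (degOnePDual Empty) (Literature.Analysis.SegalBargmann.binvPi 1) ℓ)
          (((SInstance.AR @SInstance.GOG @SInstance.hG_GOG @hGR @χV @hGR₀ @hGR₁ @hGR₂ @hGR₃ @μ @SInstance.hpos_GOG @hΔ₁ @hΔ₂ @hΔ₃ V c hG) 0).x₀) N) =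
      SupplyInstance.testFun (↥(NumberField.maximalRealSubfield L)) (Fin 3)
        (blockFamilyOfAt (L : Type) e₁ (frameD V) (frameD_real V) (frameD_ne V) (lineVec (L : Type) (dW c.D 0))
          (fun _ => dW_real c.D 0) (fun _ => dW_ne c.D 0) ι₁ (blockPosEquiv V) (blockNegEquiv V)
          (posIdxEquivUnit (SInstance.hpos_GOG V c hG).1) (negIdxEquivEmpty (SInstance.hpos_GOG V c hG).1) (degOnePDual Empty) (Literature.Analysis.SegalBargmann.binvPi 1) ℓ)
        (((SInstance.AR @SInstance.GOG @SInstance.hG_GOG @hGR @χV @hGR₀ @hGR₁ @hGR₂ @hGR₃ @μ @SInstance.hpos_GOG @hΔ₁ @hΔ₂ @hΔ₃ V c hG) 0).x₀) N)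
    (hχ₀ : ∀ {L : CMField} {ι₁ : L →+* ℂ} (V : HermSpace3 L ι₁) (c : SeesawCtx L) (hG : SInstance.GOG V c), ∀ u : MulAction.stabilizer U21 x₀,
    ((lineScalar_zero V c.D (hGR V c) (hGR₀ V c) (hGR₁ V c) (eta₀ V c.D (EtaChi.η @χV (@SInstance.χWR @hGR @hGR₀ @hGR₁ @μ) V c)) (u : U21) : ℂˣ) : ℂ) *
        ((matA (stabilizerEquivK21.symm u)).det ^
            (lineVacExponentsZero V c (hGR₀ V c) (SInstance.hG_GOG V c hG) (posIdxEquivUnit (SInstance.hpos_GOG V c hG).1)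
              (negIdxEquivEmpty (SInstance.hpos_GOG V c hG).1)).eP *
          sclD (stabilizerEquivK21.symm u) ^
            (lineVacExponentsZero V c (hGR₀ V c) (SInstance.hG_GOG V c hG) (posIdxEquivUnit (SInstance.hpos_GOG V c hG).1)
              (negIdxEquivEmpty (SInstance.hpos_GOG V c hG).1)).eQ) =
      star (sclD (stabilizerEquivK21.symm u)))
    (harch₁ : ∀ {L : CMField} {ι₁ : L →+* ℂ} (V : HermSpace3 L ι₁) (c : SeesawCtx L) (hV : IsAnisotropic L V.Hm) (hG : SInstance.GOG V c) (N : ℕ), ∀ a : UnitaryGroup.arch (↥(NumberField.maximalRealSubfield L)) L (NumberField.IsCMField.complexConj L) 3 V.Hm,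
    UnitaryGroup.archAt (↥(NumberField.maximalRealSubfield L)) L (NumberField.IsCMField.complexConj L) 3 V.Hm (UnitaryGroup.cmPlace (L : Type) ι₁)
        (NumberField.complexConj_smul_infinitePlace (L : Type) _) (NumberField.IsCMField.complexConj_ne_one (L : Type)) a = 1 →
    ∀ ℓ, lineRepD V c.D (hGR V c) (hGR₀ V c) (hGR₁ V c) (hGR₂ V c) (hGR₃ V c) (EtaChi.η @χV (@SInstance.χWR @hGR @hGR₀ @hGR₁ @μ) V c) 1
        (HodgeCM.Adelic.regimeEquiv L V.Hm hV
          (UnitaryGroup.archToAdelic (↥(NumberField.maximalRealSubfield L)) L (NumberField.IsCMField.complexConj L) 3 V.Hm a), 1)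
        (SupplyInstance.testFun (↥(NumberField.maximalRealSubfield L)) (Fin 3)
          (blockFamilyOfAt (L : Type) e₁ (frameD V) (frameD_real V) (frameD_ne V) (lineVec (L : Type) (dW c.D 1))
            (fun _ => dW_real c.D 1) (fun _ => dW_ne c.D 1) ι₁ (blockPosEquiv V) (blockNegEquiv V)
            (posIdxEquivUnit (SInstance.hpos_GOG V c hG).2.1) (negIdxEquivEmpty (SInstance.hpos_GOG V c hG).2.1) (degOnePDual Empty) (Literature.Analysis.SegalBargmann.binvPi 1) ℓ)
          (((SInstance.AR @SInstance.GOG @SInstance.hG_GOG @hGR @χV @hGR₀ @hGR₁ @hGR₂ @hGR₃ @μ @SInstance.hpos_GOG @hΔ₁ @hΔ₂ @hΔ₃ V c hG) 1).x₀) N) =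
      SupplyInstance.testFun (↥(NumberField.maximalRealSubfield L)) (Fin 3)
        (blockFamilyOfAt (L : Type) e₁ (frameD V) (frameD_real V) (frameD_ne V) (lineVec (L : Type) (dW c.D 1))
          (fun _ => dW_real c.D 1) (fun _ => dW_ne c.D 1) ι₁ (blockPosEquiv V) (blockNegEquiv V)
          (posIdxEquivUnit (SInstance.hpos_GOG V c hG).2.1) (negIdxEquivEmpty (SInstance.hpos_GOG V c hG).2.1) (degOnePDual Empty) (Literature.Analysis.SegalBargmann.binvPi 1) ℓ)
        (((SInstance.AR @SInstance.GOG @SInstance.hG_GOG @hGR @χV @hGR₀ @hGR₁ @hGR₂ @hGR₃ @μ @SInstance.hpos_GOG @hΔ₁ @hΔ₂ @hΔ₃ V c hG) 1).x₀) N)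
    (hχ₁ : ∀ {L : CMField} {ι₁ : L →+* ℂ} (V : HermSpace3 L ι₁) (c : SeesawCtx L) (hG : SInstance.GOG V c), ∀ u : MulAction.stabilizer U21 x₀,
    ((lineScalar_one V c.D (hGR V c) (hGR₀ V c) (hGR₁ V c) (eta₁ V c.D (EtaChi.η @χV (@SInstance.χWR @hGR @hGR₀ @hGR₁ @μ) V c)) (u : U21) : ℂˣ) : ℂ) *
        ((matA (stabilizerEquivK21.symm u)).det ^
            (lineVacExponentsOne V c (hGR₁ V c) (SInstance.hG_GOG V c hG) (posIdxEquivUnit (SInstance.hpos_GOG V c hG).2.1)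
              (negIdxEquivEmpty (SInstance.hpos_GOG V c hG).2.1)).eP *
          sclD (stabilizerEquivK21.symm u) ^
            (lineVacExponentsOne V c (hGR₁ V c) (SInstance.hG_GOG V c hG) (posIdxEquivUnit (SInstance.hpos_GOG V c hG).2.1)
              (negIdxEquivEmpty (SInstance.hpos_GOG V c hG).2.1)).eQ) =
      star (sclD (stabilizerEquivK21.symm u)))
    (CT : ∀ {L : CMField} {ι₁ : L →+* ℂ} (V : HermSpace3 L ι₁) (c : SeesawCtx L)
      (hc : (thetaModelOf hHD hI h₁ (cmAbelianVarietyRealised_of_eigenbasis hHD hI h₃) (orientBitι L ι₁) (embOf hHD hI h₁ (cmAbelianVarietyRealised_of_eigenbasis hHD hI h₃)) (coverOf hHD hI h₁ (cmAbelianVarietyRealised_of_eigenbasis hHD hI h₃) hA)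
        (wmOfInput (HypCensus.Wcm hGR (@EtaChi.η @χV (@SInstance.χWR @hGR @hGR₀ @hGR₁ @μ)) (@EtaChi.hη @χV (@SInstance.χWR @hGR @hGR₀ @hGR₁ @μ))
          (@EtaChi.hηc @χV (@SInstance.χWR @hGR @hGR₀ @hGR₁ @μ))))
        (thetaOf _ (thetaClassInputOf _ (fun V c => thetaSpaceInputOf hHD hI h₁ (cmAbelianVarietyRealised_of_eigenbasis hHD hI h₃) (SInstance.SROG @hGR @χV @hGR₀ @hGR₁ @hGR₂ @hGR₃ @μ hΔ₁ hΔ₂ hΔ₃) V c)))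
        (d12Of μ) (d34Of μ)).GoodCtx ι₁ c) (hK : Module.finrank ℚ c.K = 6 ∧ IsNormalClosure ℚ c.K L ∧ (Module.finrank ℚ L = 24 ∨ Module.finrank ℚ L = 48)),
      (NumberField.InfinitePlace.mk ι₁).embedding = ι₁ →
      Gen12PinsP.Real34CensusSideT @SInstance.GOG @SInstance.hG_GOG @hGR (@EtaChi.η @χV (@SInstance.χWR @hGR @hGR₀ @hGR₁ @μ))
        (@EtaChi.hη @χV (@SInstance.χWR @hGR @hGR₀ @hGR₁ @μ)) (@EtaChi.hηc @χV (@SInstance.χWR @hGR @hGR₀ @hGR₁ @μ)) @hGR₀ @hGR₁ @hGR₂ @hGR₃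
        (@SInstance.AR @SInstance.GOG @SInstance.hG_GOG @hGR @χV @hGR₀ @hGR₁ @hGR₂ @hGR₃ @μ @SInstance.hpos_GOG
          (fun V c hc => hΔ₁ V c hc) (fun V c hc => hΔ₂ V c hc) (fun V c hc => hΔ₃ V c hc))
        hHD hI h₁ (cmAbelianVarietyRealised_of_eigenbasis hHD hI h₃) (orientBitι L ι₁) hA @μ V c (isAnisotropic_of_goodCtx V hc hK.1))
    (jD : ∀ {L : CMField} {ι₁ : L →+* ℂ} (_V : HermSpace3 L ι₁) (_c : SeesawCtx L), NumberField.InfinitePlace (L : Type) → Fock.EqVar → Fin 6)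
    (hκ : ∀ {L : CMField} {ι₁ : L →+* ℂ} (V : HermSpace3 L ι₁) (c : SeesawCtx L)
      (hW : (∀ j, 0 < (ι₁ ((dW c.D) j)).re) ∨ ∀ j, (ι₁ ((dW c.D) j)).re < 0), ∀ k : ↥(KInfty V),
      (((@EtaChi.η @χV (@SInstance.χWR @hGR @hGR₀ @hGR₁ @μ)) V c (HypCensus.kPair V c.D ι₁ V.sylvesterFrame (sylvesterFrame_formCongr V) k) : ℂˣ) : ℂ) *
          ((HypCensus.pinLetterChar V c.D (hGR V c) hW (HypCensus.kVLetters V c.D (HypCensus.lett V c.D k)) : Circle) : ℂ) * HypCensus.dVIota V c.D (HypCensus.lett V c.D k (HypCensus.cmPlace (L : Type) ι₁)) =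
        ((Literature.NumberTheory.Automorphic.UnitaryGroup.archKappa (L : Type) V.Hm ι₁ V.sylvesterFrame (sylvesterFrame_formCongr V) k : ℂˣ) : ℂ))
    (homg : ∀ {L : CMField} {ι₁ : L →+* ℂ} (V : HermSpace3 L ι₁) (c : SeesawCtx L)
      (hW : (∀ j, 0 < (ι₁ ((dW c.D) j)).re) ∨ ∀ j, (ι₁ ((dW c.D) j)).re < 0) (f : FinSB ↥(NumberField.maximalRealSubfield L) (Fin 6))
      (t : (HypCensus.printedAt V c.D hW (jD V c) (fun w => -μ c 0 w) (fun w => -μ c 1 w)).Tg)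
      (φ : (HypCensus.printedAt V c.D hW (jD V c) (fun w => -μ c 0 w) (fun w => -μ c 1 w)).F),
      HypCensus.omgW (HypCensus.Wcm hGR (@EtaChi.η @χV (@SInstance.χWR @hGR @hGR₀ @hGR₁ @μ)) (@EtaChi.hη @χV (@SInstance.χWR @hGR @hGR₀ @hGR₁ @μ)) (@EtaChi.hηc @χV (@SInstance.χWR @hGR @hGR₀ @hGR₁ @μ)) V c)
          (_root_.NumberField.SeesawArchTorus.printedTorusHom (HypCensus.kindOf (L : Type) (frameD V) (frameD_real V) (dW c.D) (dW_real c.D) ι₁ (HypCensus.datumAt V c.D (jD V c) (HypCensus.jIOf V c.D hW)))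
            (HypCensus.lamOf (L : Type) (frameD V) (frameD_real V) (dW c.D) (dW_real c.D) ι₁ (HypCensus.datumAt V c.D (jD V c) (HypCensus.jIOf V c.D hW)))
            (HypCensus.lamOf_ne_zero (L : Type) (frameD V) (frameD_real V) (dW c.D) (dW_real c.D) ι₁ (HypCensus.datumAt V c.D (jD V c) (HypCensus.jIOf V c.D hW)))
            (c.D.jT₁₂.toMonoidHom.comp (_root_.NumberField.SeesawArchTorus.toAdeles (L : Type)))
            (Fock.PrintDict.pinnedVacs (HypCensus.kindOf (L : Type) (frameD V) (frameD_real V) (dW c.D) (dW_real c.D) ι₁ (HypCensus.datumAt V c.D (jD V c) (HypCensus.jIOf V c.D hW)))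
              (fun w => -μ c 0 w) (fun w => -μ c 1 w)) t)
          (HypCensus.ins (L : Type) (frameD V) (frameD_real V) (frameD_ne V) (dW c.D) (dW_real c.D) (dW_ne c.D) ι₁ (HypCensus.datumAt V c.D (jD V c) (HypCensus.jIOf V c.D hW))
            (fun w => -μ c 0 w) (fun w => -μ c 1 w) f φ) =
        HypCensus.ins (L : Type) (frameD V) (frameD_real V) (frameD_ne V) (dW c.D) (dW_real c.D) (dW_ne c.D) ι₁ (HypCensus.datumAt V c.D (jD V c) (HypCensus.jIOf V c.D hW))
          (fun w => -μ c 0 w) (fun w => -μ c 1 w) f ((HypCensus.printedAt V c.D hW (jD V c) (fun w => -μ c 0 w) (fun w => -μ c 1 w)).ωT t φ))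
    (homg₃₄ : ∀ {L : CMField} {ι₁ : L →+* ℂ} (V : HermSpace3 L ι₁) (c : SeesawCtx L)
      (hW : (∀ j, 0 < (ι₁ ((dW c.D) j)).re) ∨ ∀ j, (ι₁ ((dW c.D) j)).re < 0) (f : FinSB ↥(NumberField.maximalRealSubfield L) (Fin 6))
      (t : (HypCensus.printedAt V c.D hW (jD V c) (fun w => -μ c 2 w) (fun w => -μ c 3 w)).Tg)
      (φ : (HypCensus.printedAt V c.D hW (jD V c) (fun w => -μ c 2 w) (fun w => -μ c 3 w)).F),
      HypCensus.omgW (HypCensus.Wcm hGR (@EtaChi.η @χV (@SInstance.χWR @hGR @hGR₀ @hGR₁ @μ)) (@EtaChi.hη @χV (@SInstance.χWR @hGR @hGR₀ @hGR₁ @μ)) (@EtaChi.hηc @χV (@SInstance.χWR @hGR @hGR₀ @hGR₁ @μ)) V c)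
          (_root_.NumberField.SeesawArchTorus.printedTorusHom (HypCensus.kindOf (L : Type) (frameD V) (frameD_real V) (dW c.D) (dW_real c.D) ι₁ (HypCensus.datumAt V c.D (jD V c) (HypCensus.jIOf V c.D hW)))
            (HypCensus.lamOf (L : Type) (frameD V) (frameD_real V) (dW c.D) (dW_real c.D) ι₁ (HypCensus.datumAt V c.D (jD V c) (HypCensus.jIOf V c.D hW)))
            (HypCensus.lamOf_ne_zero (L : Type) (frameD V) (frameD_real V) (dW c.D) (dW_real c.D) ι₁ (HypCensus.datumAt V c.D (jD V c) (HypCensus.jIOf V c.D hW)))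
            (c.D.jT₃₄.toMonoidHom.comp (_root_.NumberField.SeesawArchTorus.toAdeles (L : Type)))
            (Fock.PrintDict.pinnedVacs (HypCensus.kindOf (L : Type) (frameD V) (frameD_real V) (dW c.D) (dW_real c.D) ι₁ (HypCensus.datumAt V c.D (jD V c) (HypCensus.jIOf V c.D hW)))
              (fun w => -μ c 2 w) (fun w => -μ c 3 w)) t)
          (HypCensus.ins₃₄ V c.D (hGR V c) ((@EtaChi.η @χV (@SInstance.χWR @hGR @hGR₀ @hGR₁ @μ)) V c) (HypCensus.datumAt V c.D (jD V c) (HypCensus.jIOf V c.D hW)) (fun w => -μ c 2 w) (fun w => -μ c 3 w) f φ) =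
        HypCensus.ins₃₄ V c.D (hGR V c) ((@EtaChi.η @χV (@SInstance.χWR @hGR @hGR₀ @hGR₁ @μ)) V c) (HypCensus.datumAt V c.D (jD V c) (HypCensus.jIOf V c.D hW)) (fun w => -μ c 2 w) (fun w => -μ c 3 w) f
          ((HypCensus.printedAt V c.D hW (jD V c) (fun w => -μ c 2 w) (fun w => -μ c 3 w)).ωT t φ))
    (hdense₁₂ : ∀ {L : CMField} {ι₁ : L →+* ℂ} (V : HermSpace3 L ι₁) (c : SeesawCtx L)
      (hW : (∀ j, 0 < (ι₁ ((dW c.D) j)).re) ∨ ∀ j, (ι₁ ((dW c.D) j)).re < 0),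
      ∀ Φ ∈ (HypCensus.Wcm hGR (@EtaChi.η @χV (@SInstance.χWR @hGR @hGR₀ @hGR₁ @μ)) (@EtaChi.hη @χV (@SInstance.χWR @hGR @hGR₀ @hGR₁ @μ)) (@EtaChi.hηc @χV (@SInstance.χWR @hGR @hGR₀ @hGR₁ @μ)) V c).SK, HypCensus.toTop (HypCensus.Wcm hGR (@EtaChi.η @χV (@SInstance.χWR @hGR @hGR₀ @hGR₁ @μ)) (@EtaChi.hη @χV (@SInstance.χWR @hGR @hGR₀ @hGR₁ @μ)) (@EtaChi.hηc @χV (@SInstance.χWR @hGR @hGR₀ @hGR₁ @μ)) V c) Φ ∈ closure (HypCensus.toTop (HypCensus.Wcm hGR (@EtaChi.η @χV (@SInstance.χWR @hGR @hGR₀ @hGR₁ @μ)) (@EtaChi.hη @χV (@SInstance.χWR @hGR @hGR₀ @hGR₁ @μ)) (@EtaChi.hηc @χV (@SInstance.χWR @hGR @hGR₀ @hGR₁ @μ)) V c) ''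
        (Submodule.span ℂ (Set.range fun q : FinSB ↥(NumberField.maximalRealSubfield L) (Fin 6) ×
          (HypCensus.printedAt V c.D hW (jD V c) (fun w => -μ c 0 w) (fun w => -μ c 1 w)).F =>
          HypCensus.ins (L : Type) (frameD V) (frameD_real V) (frameD_ne V) (dW c.D) (dW_real c.D) (dW_ne c.D) ι₁ (HypCensus.datumAt V c.D (jD V c) (HypCensus.jIOf V c.D hW))
            (fun w => -μ c 0 w) (fun w => -μ c 1 w) q.1 q.2) : Set (CMSchwartz (L : Type) 6))))
    (hdense₃₄ : ∀ {L : CMField} {ι₁ : L →+* ℂ} (V : HermSpace3 L ι₁) (c : SeesawCtx L)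
      (hW : (∀ j, 0 < (ι₁ ((dW c.D) j)).re) ∨ ∀ j, (ι₁ ((dW c.D) j)).re < 0),
      ∀ Φ ∈ (HypCensus.Wcm hGR (@EtaChi.η @χV (@SInstance.χWR @hGR @hGR₀ @hGR₁ @μ)) (@EtaChi.hη @χV (@SInstance.χWR @hGR @hGR₀ @hGR₁ @μ)) (@EtaChi.hηc @χV (@SInstance.χWR @hGR @hGR₀ @hGR₁ @μ)) V c).SK, HypCensus.toTop (HypCensus.Wcm hGR (@EtaChi.η @χV (@SInstance.χWR @hGR @hGR₀ @hGR₁ @μ)) (@EtaChi.hη @χV (@SInstance.χWR @hGR @hGR₀ @hGR₁ @μ)) (@EtaChi.hηc @χV (@SInstance.χWR @hGR @hGR₀ @hGR₁ @μ)) V c) Φ ∈ closure (HypCensus.toTop (HypCensus.Wcm hGR (@EtaChi.η @χV (@SInstance.χWR @hGR @hGR₀ @hGR₁ @μ)) (@EtaChi.hη @χV (@SInstance.χWR @hGR @hGR₀ @hGR₁ @μ)) (@EtaChi.hηc @χV (@SInstance.χWR @hGR @hGR₀ @hGR₁ @μ)) V c) ''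
        (Submodule.span ℂ (Set.range fun q : FinSB ↥(NumberField.maximalRealSubfield L) (Fin 6) ×
          (HypCensus.printedAt V c.D hW (jD V c) (fun w => -μ c 2 w) (fun w => -μ c 3 w)).F =>
          HypCensus.ins (L : Type) (frameD V) (frameD_real V) (frameD_ne V) (dW c.D) (dW_real c.D) (dW_ne c.D) ι₁ (HypCensus.datumAt V c.D (jD V c) (HypCensus.jIOf V c.D hW))
            (fun w => -μ c 2 w) (fun w => -μ c 3 w) q.1 q.2) : Set (CMSchwartz (L : Type) 6)))) :
     (picardCMUniverse hHD hI h₁ (cmAbelianVarietyRealised_of_eigenbasis hHD hI h₃)).PerL :=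
  perL_picardCM_r21AEOGISCW hHD hI h₁ h₃ hA hGR χV hGR₀ hGR₁ hGR₂ hGR₃ μ hΔ₁ hΔ₂ hΔ₃ hR hΘ harch₀ hχ₀ harch₁ hχ₁
    (Gen12PinsP.real34_ROGET hGR χV hGR₀ hGR₁ hGR₂ hGR₃ μ hΔ₁ hΔ₂ hΔ₃ hHD hI h₁ (cmAbelianVarietyRealised_of_eigenbasis hHD hI h₃) hA
      (fact_cmInflation_riemann hHD hI (cmAbelianVarietyRealised_of_eigenbasis hHD hI h₃) h₁ hR)
      (fun {L} {ι₁} V c hc h6 hcan i Γ =>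
        (thetaModelOf hHD hI h₁ (cmAbelianVarietyRealised_of_eigenbasis hHD hI h₃) (orientBitι L ι₁) (embOf hHD hI h₁ (cmAbelianVarietyRealised_of_eigenbasis hHD hI h₃)) (coverOf hHD hI h₁ (cmAbelianVarietyRealised_of_eigenbasis hHD hI h₃) hA) (wmOfInput (HypCensus.Wcm hGR (@EtaChi.η @χV (@SInstance.χWR @hGR @hGR₀ @hGR₁ @μ)) (@EtaChi.hη @χV (@SInstance.χWR @hGR @hGR₀ @hGR₁ @μ)) (@EtaChi.hηc @χV (@SInstance.χWR @hGR @hGR₀ @hGR₁ @μ))))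
          (thetaOf _ (thetaClassInputOf _ (fun V c => thetaSpaceInputOf hHD hI h₁ (cmAbelianVarietyRealised_of_eigenbasis hHD hI h₃) (SInstance.SROG @hGR @χV @hGR₀ @hGR₁ @hGR₂ @hGR₃ @μ hΔ₁ hΔ₂ hΔ₃) V c))) (d12Of μ) (d34Of μ)).isotypic_of_small
          (levelTransferFamilyOf hHD hI h₁ (cmAbelianVarietyRealised_of_eigenbasis hHD hI h₃) hA (normOf hHD hI h₁ (cmAbelianVarietyRealised_of_eigenbasis hHD hI h₃) hA)
            (pushOf_comp_pull_eq_pull_normOf hHD hI h₁ (cmAbelianVarietyRealised_of_eigenbasis hHD hI h₃) hA))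
          V c i
          (thetaSatOf hHD hI h₁ (cmAbelianVarietyRealised_of_eigenbasis hHD hI h₃) (S := (SInstance.SROG @hGR @χV @hGR₀ @hGR₁ @hGR₂ @hGR₃ @μ hΔ₁ hΔ₂ hΔ₃)) (orientBitι L ι₁)
            (embOf hHD hI h₁ (cmAbelianVarietyRealised_of_eigenbasis hHD hI h₃)) (wmOfInput (HypCensus.Wcm hGR (@EtaChi.η @χV (@SInstance.χWR @hGR @hGR₀ @hGR₁ @μ)) (@EtaChi.hη @χV (@SInstance.χWR @hGR @hGR₀ @hGR₁ @μ)) (@EtaChi.hηc @χV (@SInstance.χWR @hGR @hGR₀ @hGR₁ @μ)))) (d12Of μ) (d34Of μ) hA V c i)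
          (by
            obtain ⟨Γ₀, hΓ₀⟩ := hΘ V c hc h6 hcan i
            refine ⟨Γ₀, fun Γ hΓ => ?_⟩
            obtain ⟨D, hsub⟩ := hΓ₀ Γ hΓ
            refine ⟨c.K, RingHom.id _, c.σ, RingHom.comp_id _, ?_⟩
            rw [HodgeCM.CMTypeOps.inflate_id]
            exact fun x hx =>
              span_classes_le_Uiso hHD hI h₁ (cmAbelianVarietyRealised_of_eigenbasis hHD hI h₃) hR V Γ (hc.mem i) D (hsub hx))
          Γ)
      CT)
    jD hκ homg homg₃₄ hdense₁₂ hdense₃₄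

end Model

end HodgeCM
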